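import Summits.Ventures.Crystal3D.Theorems.StickyWulffConstantTextureLiminfTexShadowLevelReachPlatesCut
import Summits.Ventures.Crystal3D.Theorems.StickyWulffConstantTextureLiminfTexShadowLevelReachInvariant
import Summits.Ventures.Crystal3D.Theorems.StickyWulffConstantTextureLiminfTexShadowWordNoEntryBarlow
import HarnessLib

/-!
# The CO-SLOT (threading) class of the plate word net: a root-class-only census with the cut, and its ROOT-FRAME top exclusion
# (lane T, crux `TextureLiminfV5`, stmt-Ventures-23912, registered stub `stub_terraceCensus`; (β)-lite B1/B2/B2′ × the cut census; threading term)

HONEST FRAMING. Venture `Summits/Ventures/Crystal3D` (cell `crystal3d-full`), route `route-Ventures-StickyWulffConstant`, helper `--supports` the law-v5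
crux `TextureLiminfV5` (stmt-Ventures-23912), lane T (HOME/wall-p1-g20/BETA-LITE-g20.md (N2) threading; HOME/wall-p1-g22/BETA-CUT-g22.md §3, §5(1)).
Census-free, certificate-free; `KissingGap δ`, `KissingClassification δ` BY NAME as in lane F's census; nothing about energies; F-C1 not moved.

THE POINT.  (β)-lite's plate root budget (B1) excludes the ONE root class that can thread a coherent filling of a two-letter word into the receiving plate —
the co-slot, polar to both letter planes (BETA-LITE (N2); on edge-on faulted pairs it costs up to `√2` per plate, hexagon-only joint flux 2.19–2.41
instead of ≥ 4.83).  With `word_family_endPairs_plates_cuts` (…LevelReachPlatesCut p743337) and the cut set `C` = ALL letters crossed upward by the root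
(`hCall`), the co-slot's walks NEVER leave the root class:
* **`coSlot_endPairs_plates`** — the plates census for such a root with the internal invariant «class `= []` ∧ predecessor present»: `hPcross` is
  VACUOUS, the top exclusion is needed for ROOT-FRAME faces only (`hPexcl0root`), the sources need no invariant clause, and
  `#{sources} ≤ #T + #CUT + 220·(#rim_top + #rim_bot)` with `CUT` = root-class readings of a cut letter's twin in the window reached by a root line
  (coherent terrace balls of the letter planes — where the (β) mirror launches live) and `T` with lane F's four exported properties;
* the root-frame top exclusion DISCHARGED for word-related receiving plates — `image_fccSlots_ne_wordFrame_of_ne_nil` (a NON-EMPTY reduced admissible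
  word moves the slot dozen), `hPexcl0_root_of_wordPlate` (receiving balls FULL in a frame whose dozen is a non-trivial word image of the root dozen;
  B2 without the in-plane hypothesis, root class only), `hPexcl0_root_of_receivingBarlowPlate` (clamped FAULTED receiving plate, both plate dozens
  non-trivial word images of the root dozen; B2′ likewise, via 19481-p2's `frame_of_face_receivingPlateBall`).
WHAT THIS IS NOT: the flux numbers (memo §3: plates-only `W/A ≥ 0.536` on both basal tilts ≥ 77.1° at `s⋆ = 9/2`), any bound on `#CUT`, any certificate;
F-C1 not moved.
-/

noncomputable section

namespace Summit.Ventures.Crystal3D.Theorems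

open Summit.Ventures.Crystal3D Finset
open Literature.MathematicalPhysics.StatisticalMechanics (barlowPos barlowStacking IsHaggSeq basalMirror)
open Summit.Ventures.Crystal3D.Cruxes.TextureLiminf.TexShadow (E3 stacking)
open scoped InnerProductSpace

/-! ## The root frame is not a non-trivial word image of itself -/

/-- **A NON-EMPTY reduced admissible word moves the slot dozen**: `B '' S ≠ wordFrame B w₀ '' S` for `w₀ ≠ []`. -/
theorem image_fccSlots_ne_wordFrame_of_ne_nil (B : E3 ≃ₗᵢ[ℝ] E3) {w₀ : List E3}
    (hw₀l : ∀ μ ∈ w₀, ‖μ‖ = 1 ∧ ∀ w ∈ fccSlots, ⟪w, μ⟫_ℝ = 0 ∨ ⟪w, μ⟫_ℝ = Real.sqrt (2 / 3) ∨ ⟪w, μ⟫_ℝ = -Real.sqrt (2 / 3))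
    (hw₀c : List.IsChain (fun μ μ' => ⟪μ, μ'⟫_ℝ = 1 / 3 ∨ ⟪μ, μ'⟫_ℝ = -1 / 3) w₀) (hw₀ne : w₀ ≠ []) :
    (B : E3 → E3) '' ↑fccSlots ≠ (wordFrame B w₀ : E3 → E3) '' ↑fccSlots := by
  intro h
  have h' : (wordFrame B [] : E3 → E3) '' ↑fccSlots = (wordFrame B w₀ : E3 → E3) '' ↑fccSlots := h
  have hmap := map_reflection_eq_of_image_eq B (κ := []) (κ' := w₀) (by simp) List.IsChain.nil hw₀l hw₀c h'
  rw [List.map_nil, eq_comm, List.map_eq_nil_iff] at hmap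
  exact hw₀ne hmap

section RootTop

variable {X : Finset E3} (hX : ∀ p ∈ X, ∀ q ∈ X, p ≠ q → 1 ≤ dist p q)
  {F : List E3 → (E3 ≃ₗᵢ[ℝ] E3)} {u : List E3 → E3} {WF : List E3 → Prop}
include hX

/-- **Root-frame top exclusion at a receiving plate FULL in a non-trivial word image of the root dozen** (B2, root class only, no in-plane hypothesis):
for an invariant `P` that forces the root class, no state reads an occupied `60°` face of its frame at a ball of `P₂`. -/
theorem hPexcl0_root_of_wordPlate {w₀ : List E3}
    (hw₀l : ∀ μ ∈ w₀, ‖μ‖ = 1 ∧ ∀ w ∈ fccSlots, ⟪w, μ⟫_ℝ = 0 ∨ ⟪w, μ⟫_ℝ = Real.sqrt (2 / 3) ∨ ⟪w, μ⟫_ℝ = -Real.sqrt (2 / 3))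
    (hw₀c : List.IsChain (fun μ μ' => ⟪μ, μ'⟫_ℝ = 1 / 3 ∨ ⟪μ, μ'⟫_ℝ = -1 / 3) w₀) (hw₀ne : w₀ ≠ [])
    (G₂ : E3 ≃ₗᵢ[ℝ] E3) (hG₂ : (G₂ : E3 → E3) '' ↑fccSlots = (wordFrame (F []) w₀ : E3 → E3) '' ↑fccSlots)
    {P₂ : Finset E3} (hP₂full : ∀ b ∈ P₂, IsFull X G₂ b) (P : E3 × List E3 → Prop) (hProot : ∀ b κ, P (b, κ) → κ = []) :
    ∀ (b : E3) (κ : List E3), WF κ → P (b, κ) → b ∈ P₂ →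
      (∃ a ∈ fccSlots, ∃ a' ∈ fccSlots, ∃ a'' ∈ fccSlots,
        ⟪a, a'⟫_ℝ = 1 / 2 ∧ ⟪a, a''⟫_ℝ = 1 / 2 ∧ ⟪a', a''⟫_ℝ = 1 / 2 ∧
        b + F κ a ∈ X ∧ b + F κ a' ∈ X ∧ b + F κ a'' ∈ X) → False := by
  intro b κ _ hP hb htri
  obtain rfl := hProot b κ hP
  have hGfull := hP₂full b hb
  obtain ⟨a, ha, a', ha', a'', ha'', i1, i2, i3, h1, h2, h3⟩ := htri
  have s1 := shell_slot_of_full hX G₂ hGfull h1 (by rw [LinearIsometryEquiv.norm_map, norm_eq_one_of_mem_fccSlots ha])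
  have s2 := shell_slot_of_full hX G₂ hGfull h2 (by rw [LinearIsometryEquiv.norm_map, norm_eq_one_of_mem_fccSlots ha'])
  have s3 := shell_slot_of_full hX G₂ hGfull h3 (by rw [LinearIsometryEquiv.norm_map, norm_eq_one_of_mem_fccSlots ha''])
  obtain ⟨w₁, hw₁, e₁⟩ := s1
  obtain ⟨w₂, hw₂, e₂⟩ := s2
  obtain ⟨w₃, hw₃, e₃⟩ := s3
  have himg := image_fccSlots_eq_of_triangle (F []) G₂ ha ha' ha'' i1 i2 i3
    ⟨w₁, Finset.mem_coe.2 hw₁, e₁⟩ ⟨w₂, Finset.mem_coe.2 hw₂, e₂⟩ ⟨w₃, Finset.mem_coe.2 hw₃, e₃⟩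
  rw [hG₂] at himg
  exact image_fccSlots_ne_wordFrame_of_ne_nil (F []) hw₀l hw₀c hw₀ne himg

end RootTop

section RootTopBarlow

variable {σ₂ : ℤ → ℤ} (hσ₂ : IsHaggSeq σ₂) (L₂ : E3 ≃ₗᵢ[ℝ] E3) (s₂ : E3) {X : Finset E3}
  (hsep : ∀ p ∈ X, ∀ p' ∈ X, p ≠ p' → 1 ≤ dist p p') {W : Set E3}
  (hplate : ∀ p ∈ stacking L₂ s₂ σ₂, p ∈ W → p ∈ X)
  {F : List E3 → (E3 ≃ₗᵢ[ℝ] E3)} {WF : List E3 → Prop}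
include hσ₂ hsep hplate

/-- **Root-frame top exclusion at a clamped FAULTED receiving plate** (B2′, root class only): if the root dozen is neither of the plate's two dozens, then
for an invariant forcing the root class no state reads an occupied face of its frame at a deep plate ball. -/
theorem hPexcl0_root_of_receivingBarlowPlate
    (hne₁ : ((F []) : E3 → E3) '' ↑fccSlots ≠ (L₂ : E3 → E3) '' ↑fccSlots)
    (hne₂ : ((F []) : E3 → E3) '' ↑fccSlots ≠ ((basalMirror.trans L₂ : E3 ≃ₗᵢ[ℝ] E3) : E3 → E3) '' ↑fccSlots)
    (P₂ : Finset E3) (hP₂ : ∀ b ∈ P₂, ∃ k i j : ℤ, b = L₂ (barlowPos 1 (Real.sqrt (2 / 3)) σ₂ k i j) + s₂ ∧ ∀ x, dist b x ≤ 2 → x ∈ W)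
    (P : E3 × List E3 → Prop) (hProot : ∀ b κ, P (b, κ) → κ = []) :
    ∀ (b : E3) (κ : List E3), WF κ → P (b, κ) → b ∈ P₂ →
      (∃ a ∈ fccSlots, ∃ a' ∈ fccSlots, ∃ a'' ∈ fccSlots,
        ⟪a, a'⟫_ℝ = 1 / 2 ∧ ⟪a, a''⟫_ℝ = 1 / 2 ∧ ⟪a', a''⟫_ℝ = 1 / 2 ∧
        b + F κ a ∈ X ∧ b + F κ a' ∈ X ∧ b + F κ a'' ∈ X) → False := by
  intro b κ _ hP hb htri
  obtain rfl := hProot b κ hP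
  obtain ⟨k, i, j, rfl, hW⟩ := hP₂ b hb
  obtain ⟨a, ha, a', ha', a'', ha'', i1, i2, i3, h1, h2, h3⟩ := htri
  rcases frame_of_face_receivingPlateBall hσ₂ L₂ s₂ hsep hplate k i j hW (F []) ha ha' ha'' i1 i2 i3 h1 h2 h3 with h | h
  · exact hne₁ h
  · exact hne₂ h

/-- The same with the two «not a plate dozen» hypotheses supplied by NON-EMPTY relating words `w₀`, `w₀'` (the (β)-lite / census shape). -/
theorem hPexcl0_root_of_receivingBarlowPlate_words {w₀ w₀' : List E3}
    (hw₀l : ∀ μ ∈ w₀, ‖μ‖ = 1 ∧ ∀ w ∈ fccSlots, ⟪w, μ⟫_ℝ = 0 ∨ ⟪w, μ⟫_ℝ = Real.sqrt (2 / 3) ∨ ⟪w, μ⟫_ℝ = -Real.sqrt (2 / 3))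
    (hw₀c : List.IsChain (fun μ μ' => ⟪μ, μ'⟫_ℝ = 1 / 3 ∨ ⟪μ, μ'⟫_ℝ = -1 / 3) w₀) (hw₀ne : w₀ ≠ [])
    (hw₀'l : ∀ μ ∈ w₀', ‖μ‖ = 1 ∧ ∀ w ∈ fccSlots, ⟪w, μ⟫_ℝ = 0 ∨ ⟪w, μ⟫_ℝ = Real.sqrt (2 / 3) ∨ ⟪w, μ⟫_ℝ = -Real.sqrt (2 / 3))
    (hw₀'c : List.IsChain (fun μ μ' => ⟪μ, μ'⟫_ℝ = 1 / 3 ∨ ⟪μ, μ'⟫_ℝ = -1 / 3) w₀') (hw₀'ne : w₀' ≠ [])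
    (hL₂ : (L₂ : E3 → E3) '' ↑fccSlots = (wordFrame (F []) w₀ : E3 → E3) '' ↑fccSlots)
    (hL₂' : ((basalMirror.trans L₂ : E3 ≃ₗᵢ[ℝ] E3) : E3 → E3) '' ↑fccSlots = (wordFrame (F []) w₀' : E3 → E3) '' ↑fccSlots)
    (P₂ : Finset E3) (hP₂ : ∀ b ∈ P₂, ∃ k i j : ℤ, b = L₂ (barlowPos 1 (Real.sqrt (2 / 3)) σ₂ k i j) + s₂ ∧ ∀ x, dist b x ≤ 2 → x ∈ W)
    (P : E3 × List E3 → Prop) (hProot : ∀ b κ, P (b, κ) → κ = []) :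
    ∀ (b : E3) (κ : List E3), WF κ → P (b, κ) → b ∈ P₂ →
      (∃ a ∈ fccSlots, ∃ a' ∈ fccSlots, ∃ a'' ∈ fccSlots,
        ⟪a, a'⟫_ℝ = 1 / 2 ∧ ⟪a, a''⟫_ℝ = 1 / 2 ∧ ⟪a', a''⟫_ℝ = 1 / 2 ∧
        b + F κ a ∈ X ∧ b + F κ a' ∈ X ∧ b + F κ a'' ∈ X) → False :=
  hPexcl0_root_of_receivingBarlowPlate hσ₂ L₂ s₂ hsep hplate
    (by rw [hL₂]; exact image_fccSlots_ne_wordFrame_of_ne_nil (F []) hw₀l hw₀c hw₀ne)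
    (by rw [hL₂']; exact image_fccSlots_ne_wordFrame_of_ne_nil (F []) hw₀'l hw₀'c hw₀'ne) P₂ hP₂ P hProot

end RootTopBarlow

/-! ## The co-slot census: root class only -/

section CoSlot

variable {X : Finset E3} {F : List E3 → (E3 ≃ₗᵢ[ℝ] E3)} {u : List E3 → E3} {WF : List E3 → Prop} {next : List E3 → E3 → List E3}
  {P' P₂ : Finset E3} {R₀ h ρ : ℝ}

open scoped Classical in
/-- **THE CO-SLOT CENSUS.**  Lane F's plates census for a root ALL of whose upward crossing letters are cut (`hCall`: every menu normal `m` of `F []` with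
`⟪F [] (u []), m⟫ = √(2/3)` has `C ((F [])⁻¹ m)` — e.g. the co-slot of a two-letter word with `C` = both letters): the walks stay in the root class, so no
cross clause is needed, the top exclusion is the root-frame one (`hPexcl0root`), and the sources carry no invariant clause.  Conclusion: `#{core sources
stepping into the window} ≤ #T + #CUT + 220·(#rim_top + #rim_bot)`, `CUT` = root-class readings of `(F [], F [] μ)`, `C μ`, in the window reached by
a root line; `T` with lane F's four exported properties (end ball / predecessor / contact / window; two payers; the end ball is a certified root state;
a moving predecessor with `IsEndMove`). -/
theorem coSlot_endPairs_plates (ver : WordVersion) {δ : ℝ} (hg : KissingGap δ) (hc : KissingClassification δ)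
    (hX : ∀ p ∈ X, ∀ q ∈ X, p ≠ q → 1 ≤ dist p q)
    (hFc : ∀ μ κ, F (μ :: κ) = ((ℝ ∙ μ)ᗮ.reflection).trans (F κ))
    (hu : ∀ κ, u κ ∈ fccSlots) (huc : ∀ μ κ, u (μ :: κ) = -u κ)
    (hWF0 : WF [])
    (hWFc : ∀ μ κ, WF (μ :: κ) ↔ (WF κ ∧ ‖μ‖ = 1 ∧
      (∀ w ∈ fccSlots, ⟪w, μ⟫_ℝ = 0 ∨ ⟪w, μ⟫_ℝ = Real.sqrt (2 / 3) ∨ ⟪w, μ⟫_ℝ = -Real.sqrt (2 / 3)) ∧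
      ⟪u κ, μ⟫_ℝ = Real.sqrt (2 / 3) ∧ ∀ μ' κ', κ = μ' :: κ' → μ' ≠ -μ))
    (hnext_pop : ∀ μ κ' (m : E3), (F (μ :: κ')).symm m = -μ → next (μ :: κ') m = κ')
    (hnext_push : ∀ κ (m : E3), (∀ μ κ', κ = μ :: κ' → (F κ).symm m ≠ -μ) → next κ m = (F κ).symm m :: κ)
    -- the cut letters: crossed upward by the root, and EVERY upward crossing letter of the root is cut
    (C : E3 → Prop) (hC : ∀ μ, C μ → ⟪u [], μ⟫_ℝ = Real.sqrt (2 / 3))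
    (hCall : ∀ m, IsMenuNormal (F []) m → ⟪F [] (u []), m⟫_ℝ = Real.sqrt (2 / 3) → C ((F []).symm m))
    -- the ROOT-FRAME top exclusion
    (hPexcl0root : ∀ b : E3, b ∈ P₂ →
      (∃ a ∈ fccSlots, ∃ a' ∈ fccSlots, ∃ a'' ∈ fccSlots,
        ⟪a, a'⟫_ℝ = 1 / 2 ∧ ⟪a, a''⟫_ℝ = 1 / 2 ∧ ⟪a', a''⟫_ℝ = 1 / 2 ∧
        b + F [] a ∈ X ∧ b + F [] a' ∈ X ∧ b + F [] a'' ∈ X) → False)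
    (hup : 0 < (F [] (u [])) 2) (hR₀ : 3 ≤ R₀) (hρ : R₀ ≤ ρ)
    -- the bottom plate's CORE and its SOURCES (no invariant clause)
    (srcOK : E3 → Prop) (hP'top : ∀ p ∈ P', p 2 ≤ -R₀ - 1)
    (hPsrc : ∀ p ∈ P', srcOK p → p ∈ X ∧
      (∃ a ∈ fccSlots, ∃ a' ∈ fccSlots, ∃ a'' ∈ fccSlots,
        ⟪a, a'⟫_ℝ = 1 / 2 ∧ ⟪a, a''⟫_ℝ = 1 / 2 ∧ ⟪a', a''⟫_ℝ = 1 / 2 ∧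
        p + F [] a ∈ X ∧ p + F [] a' ∈ X ∧ p + F [] a'' ∈ X) ∧
      p - F [] (u []) ∈ X ∧
      (IsFull X (F []) p ∨ (∃ m, IsTwinReading X (F []) m p ∧ ⟪F [] (u []), m⟫_ℝ = 0) ∨
        (ver = WordVersion.v2 ∧ IsNarrow X (F []) (F [] (u [])) p)))
    (hstd : ∀ κ, WF κ → ∀ p ∈ P', (∃ a ∈ fccSlots, ∃ a' ∈ fccSlots, ∃ a'' ∈ fccSlots,
        ⟪a, a'⟫_ℝ = 1 / 2 ∧ ⟪a, a''⟫_ℝ = 1 / 2 ∧ ⟪a', a''⟫_ℝ = 1 / 2 ∧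
        p + F κ a ∈ X ∧ p + F κ a' ∈ X ∧ p + F κ a'' ∈ X) → F κ (u κ) = F [] (u []))
    (hsealB : ∀ s ∈ X, s ∉ P' → -R₀ - 1 - 1 ≤ s 2 → s 2 < -R₀ - 1 → s 0 ^ 2 + s 1 ^ 2 ≤ (ρ - 1) ^ 2 → False)
    (hP₂seal : ∀ s ∈ X, h + R₀ + 1 ≤ s 2 → s 2 ≤ h + R₀ + 1 + 1 → s 0 ^ 2 + s 1 ^ 2 ≤ (ρ - 2) ^ 2 → s ∈ P₂) :
    ∃ T : Finset (E3 × E3),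
      (P'.filter fun p => srcOK p ∧ -R₀ - 1 < (p + F [] (u [])) 2 ∧ (p + F [] (u [])) 2 < h + R₀ + 1).card ≤
        T.card +
        (X.filter fun b => -R₀ - 1 ≤ b 2 ∧ b 2 < h + R₀ + 1 ∧ (∃ μ, C μ ∧ IsTwinReading X (F []) (F [] μ) b) ∧
            b - F [] (u []) ∈ X).card +
        220 * (X.filter fun s => h + R₀ + 1 ≤ s 2 ∧ s 2 ≤ h + R₀ + 1 + 1 ∧ (ρ - 2) ^ 2 < s 0 ^ 2 + s 1 ^ 2).card +
        220 * (X.filter fun s => -R₀ - 1 - 1 ≤ s 2 ∧ s 2 < -R₀ - 1 ∧ (ρ - 1) ^ 2 < s 0 ^ 2 + s 1 ^ 2).card ∧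
      (∀ bq ∈ T, bq.1 ∈ X ∧ bq.2 ∈ X ∧ dist bq.1 bq.2 = 1 ∧ -R₀ - 1 ≤ bq.1 2 ∧ bq.1 2 < h + R₀ + 1) ∧
      (∀ bq ∈ T, (X.filter fun q => dist bq.1 q = 1).card ≤ 11 ∨
        ∃ z₁ ∈ X, ∃ z₂ ∈ X, z₁ ≠ z₂ ∧ dist bq.1 z₁ = 1 ∧ dist bq.1 z₂ = 1 ∧
          (X.filter fun q => dist z₁ q = 1).card ≤ 11 ∧ (X.filter fun q => dist z₂ q = 1).card ≤ 11) ∧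
      (∀ bq ∈ T, bq.1 - F [] (u []) ∈ X) ∧
      (∀ bq ∈ T, ∃ κ, WF κ ∧ bq.2 - F κ (u κ) ∈ X ∧ IsEndMove X ver (F κ) (F κ (u κ)) bq.2 bq.1) := by
  -- the internal invariant: ROOT class and predecessor present
  set P : E3 × List E3 → Prop := fun v => v.2 = [] ∧ (v.1 ∈ X ∧ v.1 - F v.2 (u v.2) ∈ X) with hPdef
  have hPstraight : ∀ (b : E3) (κ : List E3), WF κ →
      (IsFull X (F κ) b ∨ (∃ m, IsTwinReading X (F κ) m b ∧ ⟪F κ (u κ), m⟫_ℝ = 0) ∨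
        (ver = WordVersion.v2 ∧ IsNarrow X (F κ) (F κ (u κ)) b)) → P (b, κ) → P (b + F κ (u κ), κ) := by
    rintro b κ - hmv ⟨hnil, hb⟩
    exact ⟨hnil, predInv_straight hu hmv hb⟩
  have hPcross : ∀ (b : E3) (κ : List E3) (m : E3), WF κ → WF (next κ m) → IsTwinReading X (F κ) m b →
      ⟪F κ (u κ), m⟫_ℝ = Real.sqrt (2 / 3) → (κ ≠ [] ∨ ¬ C ((F []).symm m)) → P (b, κ) → P (b + F (next κ m) (u (next κ m)), next κ m) := by
    rintro b κ m - - htd hdm hoff ⟨hnil, -⟩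
    exfalso
    have hnil' : κ = [] := hnil
    subst hnil'
    rcases hoff with h0 | h0
    · exact h0 rfl
    · exact h0 (hCall m htd.1 hdm)
  have hPexcl0 : ∀ (b : E3) (κ : List E3), WF κ → P (b, κ) → b ∈ P₂ →
      (∃ a ∈ fccSlots, ∃ a' ∈ fccSlots, ∃ a'' ∈ fccSlots,
        ⟪a, a'⟫_ℝ = 1 / 2 ∧ ⟪a, a''⟫_ℝ = 1 / 2 ∧ ⟪a', a''⟫_ℝ = 1 / 2 ∧
        b + F κ a ∈ X ∧ b + F κ a' ∈ X ∧ b + F κ a'' ∈ X) → False := by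
    rintro b κ - ⟨hnil, -⟩ hb htri
    have hnil' : κ = [] := hnil
    subst hnil'
    exact hPexcl0root b hb htri
  have hPsrc' : ∀ p ∈ P', srcOK p → p ∈ X ∧
      (∃ a ∈ fccSlots, ∃ a' ∈ fccSlots, ∃ a'' ∈ fccSlots,
        ⟪a, a'⟫_ℝ = 1 / 2 ∧ ⟪a, a''⟫_ℝ = 1 / 2 ∧ ⟪a', a''⟫_ℝ = 1 / 2 ∧
        p + F [] a ∈ X ∧ p + F [] a' ∈ X ∧ p + F [] a'' ∈ X) ∧
      p - F [] (u []) ∈ X ∧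
      (IsFull X (F []) p ∨ (∃ m, IsTwinReading X (F []) m p ∧ ⟪F [] (u []), m⟫_ℝ = 0) ∨
        (ver = WordVersion.v2 ∧ IsNarrow X (F []) (F [] (u [])) p)) ∧
      P (p + F [] (u []), []) := by
    intro p hp hs
    obtain ⟨hpX, hface, hpred, hmv⟩ := hPsrc p hp hs
    exact ⟨hpX, hface, hpred, hmv, rfl, predInv_straight hu hmv ⟨hpX, hpred⟩⟩
  obtain ⟨T, hbound, h1, h2, h3, h4⟩ := word_family_endPairs_plates_cuts ver hg hc hX hFc hu huc hWF0 hWFc hnext_pop hnext_push C hC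
    hPstraight hPcross hPexcl0 hup hR₀ hρ srcOK hP'top hPsrc' hstd hsealB hP₂seal
  refine ⟨T, hbound.trans ?_, h1, h2, ?_, h4⟩
  · -- drop the invariant clause from the cut term
    refine Nat.add_le_add_right (Nat.add_le_add_right (Nat.add_le_add_left (card_le_card fun b hb => ?_) _) _) _
    simp only [Finset.mem_filter] at hb ⊢
    exact ⟨hb.1, hb.2.1, hb.2.2.1, hb.2.2.2.1, hb.2.2.2.2.2⟩
  · intro bq hbq
    obtain ⟨κ, -, hnil, -, hpred⟩ := h3 bq hbq
    have hnil' : κ = [] := hnil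
    rw [hnil'] at hpred; exact hpred

end CoSlot

end Summit.Ventures.Crystal3D.Theorems

end
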